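import Mathlib
import HarnessLib

/-!
# HANDOFF — the MOMENT EXPANSION of a trigonometric edge profile (rh-explicit, track «HANDOFF», seat prove-2 gen9, ATTEMPT-18 §3 (R-3) D1 roadmap (β))

HONEST FRAMING. Nothing here bears on the truth of RH; this is the cosine series. For a finite family of real weights `c_i` and
frequencies `θ_i`, and every real `σ`,

  `Σ_i c_i(1 − cos(θ_iσ)) = Σ_{n≥0} (−1)^n σ^{2n+2}/(2n+2)! · M_{n+1}`,   `M_n := Σ_i c_iθ_i^{2n}`   (`hasSum_sum_mul_one_sub_cos`),

and `Σ_i c_i sin²(θ_iσ/2) = ½Σ_i c_i(1 − cos θ_iσ)` (`sum_mul_sin_sq_half_eq`, `hasSum_sum_mul_sin_sq_half`). USE: with `c_k = w_k` (the dodger's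
edge weights) and `θ_k = ℓ_{k+1}` this is step (β) of the D1 roadmap (ATTEMPT-18 §3): the collar profile
`Re F₀(b−σ) = c_∞/(2b) + (1/b)Σ_k w_k sin²(ℓ_{k+1}σ/2)` (HOME `HandoffDodgerEdgeValue.lean`) becomes the absolutely convergent moment series
`2b·Re F₀(b−σ) = c_∞ + Σ_{n≥1}(−1)^{n+1}M_nσ^{2n}/(2n)!`, whose moments are read off the generating function of
`HandoffDodgerGeneratingFunction.lean`. No `sorry`, standard axioms, no definitions.

References: this track (ATTEMPT-18 §3). Folklore (cosine series).
-/

set_option linter.dupNamespace false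

noncomputable section

open Finset

namespace Summit.RiemannHypothesis.RiemannHypothesis.Theorems.Handoff

/-- `1 − cos x = Σ_{n≥0} (−1)^n x^{2n+2}/(2n+2)!`. [folklore] -/
theorem hasSum_one_sub_cos (x : ℝ) :
    HasSum (fun n : ℕ => (-1) ^ n * x ^ (2 * n + 2) / ((2 * n + 2).factorial : ℝ)) (1 - Real.cos x) := by
  have h := Real.hasSum_cos x
  have h1 := (hasSum_nat_add_iff' (f := fun n : ℕ => (-1 : ℝ) ^ n * x ^ (2 * n) / ((2 * n).factorial : ℝ)) 1).2 h
  have h0 : ∑ i ∈ range 1, (-1 : ℝ) ^ i * x ^ (2 * i) / ((2 * i).factorial : ℝ) = 1 := by simp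
  rw [h0] at h1
  have e : (fun n : ℕ => (-1 : ℝ) ^ n * x ^ (2 * n + 2) / ((2 * n + 2).factorial : ℝ)) =
      fun n : ℕ => -((-1 : ℝ) ^ (n + 1) * x ^ (2 * (n + 1)) / ((2 * (n + 1)).factorial : ℝ)) := by
    funext n
    rw [show 2 * (n + 1) = 2 * n + 2 by ring]
    ring
  rw [e, show (1 - Real.cos x) = -(Real.cos x - 1) by ring]
  exact h1.neg

/-- **Moment expansion.** `Σ_i c_i(1 − cos(θ_iσ)) = Σ_{n≥0} (−1)^nσ^{2n+2}/(2n+2)!·Σ_i c_iθ_i^{2n+2}` (absolutely convergent). [folklore] -/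
theorem hasSum_sum_mul_one_sub_cos {ι : Type*} (s : Finset ι) (c θ : ι → ℝ) (σ : ℝ) :
    HasSum (fun n : ℕ => (-1) ^ n * σ ^ (2 * n + 2) / ((2 * n + 2).factorial : ℝ) * ∑ i ∈ s, c i * θ i ^ (2 * n + 2))
      (∑ i ∈ s, c i * (1 - Real.cos (θ i * σ))) := by
  have h : ∀ i ∈ s, HasSum (fun n : ℕ => c i * ((-1) ^ n * (θ i * σ) ^ (2 * n + 2) / ((2 * n + 2).factorial : ℝ)))
      (c i * (1 - Real.cos (θ i * σ))) :=
    fun i _ => (hasSum_one_sub_cos (θ i * σ)).mul_left (c i)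
  have e : (fun n : ℕ => (-1 : ℝ) ^ n * σ ^ (2 * n + 2) / ((2 * n + 2).factorial : ℝ) * ∑ i ∈ s, c i * θ i ^ (2 * n + 2)) =
      fun n : ℕ => ∑ i ∈ s, c i * ((-1) ^ n * (θ i * σ) ^ (2 * n + 2) / ((2 * n + 2).factorial : ℝ)) := by
    funext n
    rw [Finset.mul_sum]
    exact Finset.sum_congr rfl fun i _ => by rw [mul_pow]; ring
  rw [e]
  exact hasSum_sum h

/-- Half-angle: `Σ_i c_i sin²(θ_iσ/2) = ½Σ_i c_i(1 − cos θ_iσ)`. [folklore] -/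
theorem sum_mul_sin_sq_half_eq {ι : Type*} (s : Finset ι) (c θ : ι → ℝ) (σ : ℝ) :
    ∑ i ∈ s, c i * Real.sin (θ i * σ / 2) ^ 2 = 1 / 2 * ∑ i ∈ s, c i * (1 - Real.cos (θ i * σ)) := by
  rw [Finset.mul_sum]
  refine Finset.sum_congr rfl fun i _ => ?_
  rw [Real.sin_sq_eq_half_sub, show 2 * (θ i * σ / 2) = θ i * σ by ring]
  ring

/-- **Moment expansion, half-angle form.** `Σ_i c_i sin²(θ_iσ/2) = Σ_{n≥0} (−1)^nσ^{2n+2}/(2·(2n+2)!)·Σ_i c_iθ_i^{2n+2}`. [folklore] -/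
theorem hasSum_sum_mul_sin_sq_half {ι : Type*} (s : Finset ι) (c θ : ι → ℝ) (σ : ℝ) :
    HasSum (fun n : ℕ => (-1) ^ n * σ ^ (2 * n + 2) / (2 * ((2 * n + 2).factorial : ℝ)) * ∑ i ∈ s, c i * θ i ^ (2 * n + 2))
      (∑ i ∈ s, c i * Real.sin (θ i * σ / 2) ^ 2) := by
  rw [sum_mul_sin_sq_half_eq]
  have e : (fun n : ℕ => (-1 : ℝ) ^ n * σ ^ (2 * n + 2) / (2 * ((2 * n + 2).factorial : ℝ)) * ∑ i ∈ s, c i * θ i ^ (2 * n + 2)) =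
      fun n : ℕ => 1 / 2 * ((-1 : ℝ) ^ n * σ ^ (2 * n + 2) / ((2 * n + 2).factorial : ℝ) * ∑ i ∈ s, c i * θ i ^ (2 * n + 2)) := by
    funext n
    ring
  rw [e]
  exact (hasSum_sum_mul_one_sub_cos s c θ σ).mul_left (1 / 2)

end Summit.RiemannHypothesis.RiemannHypothesis.Theorems.Handoff

end
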